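import Summits.ABC.ABC.Theorems.TameLocalReceptacle.Negative.TameLocalReceptacleFalseOfMatchingHypothesis
import Summits.ABC.ABC.Theorems.CongruentialReceptacleTameLocalReceptacleCellLawsDefs
import Summits.ABC.ABC.Theorems.CongruentialReceptacleTameLocalReceptacleFamiliesDefs
import Summits.ABC.ABC.Theorems.CongruentialReceptacleTameLocalReceptacleStubSmoothLLindelofOfGrh
import Summits.ABC.ABC.Theorems.CongruentialReceptacleTameLocalReceptacleStubFriableCharSumsOfLindelof
import Summits.ABC.ABC.Theorems.CongruentialReceptacleTameLocalReceptacleStubMatchingFamiliesOfKeyCells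
import Summits.ABC.ABC.Theorems.CongruentialReceptacleTameLocalReceptacleEngineCellsDefs
import Summits.ABC.ABC.Theorems.CongruentialReceptacleTameLocalReceptacleStubZetaDecayOfGrh
import Summits.ABC.ABC.Theorems.CongruentialReceptacleTameLocalReceptacleStubTailCells
import Summits.ABC.ABC.Theorems.CongruentialReceptacleTameLocalReceptacleStubNonemptyCells
import Summits.ABC.ABC.Theorems.CongruentialReceptacleTameLocalReceptacleStubKeyCellStructureOfCells
import Literature.NumberTheory.Sieve.SmoothZetaDecayLongRange
import Literature.NumberTheory.LFunctions.RHWave0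

/-!
# LINE SKELETON — crux `TameLocalReceptacle` (stmt-ABC-14354), line `grh-friable-cell-resolution`

Idea card `Cruxes/TameLocalReceptacle/Ideas/grh-friable-cell-resolution.md` (ideator 5, round 2; triage r2-1 PASS, r2-2 PASS).
REFUTING line, CONDITIONAL on GRH: the registered target is `NotTameLocalReceptacle := ¬ TameLocalReceptacle` and the
composition `NotTameLocalReceptacle_of_grh : GeneralizedRiemannHypothesis → NotTameLocalReceptacle` is kernel-checked
modulo the `stub_*` below (GRH is the tree's `@[conjecture]` `Literature.NumberTheory.LFunctions.GeneralizedRiemannHypothesis`;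
landing shape `--negative-modulo GeneralizedRiemannHypothesis` on stmt-ABC-14354).

The line consumes the LANDED negative lemma `TameLocalReceptacle_false_of_MatchingHypothesis` (p121503): MF = `MatchingFamilies (1/4)`
refutes the crux; MF follows from `KeyCellStructure (1/4)` (`stub_matchingFamilies_of_keyCells`, p134998), and the GRH chain
`stub_smoothLLindelof_of_grh` (p138685) → `stub_friableCharSums_of_lindelof` (p134590) supplies the currency `FriableCharSumBound`.

SKELETON v8 (lead prover-line-stmt-ABC-14354-a1-0, 2026-08-17 13:35Z; v7 with the landed stubs imported: stub_zetaDecay_of_grh p160040, stub_tailCells p160754, stub_nonemptyCells p157617, stub_keyCellStructure_of_cells p158364) — ENGINE v3 (lead NOTES `## Engine v3`): explicit witnesses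
`FA = FAfam N M y`, `FB`, `FC` (p141487), `G = FAfam 1 (2^{N-1}M) y`, `G' = FAfam 1 M y` at the master scale `x = 48·2^N·M`,
`y = ⌊(log x)^K⌋`, `K = 10⁵`, CONSTANT depth `N = N(δ)`; one saddle line `α(x,y)`; MODEL-FREE family-level targets (vocabulary of
`Theorems/CongruentialReceptacleTameLocalReceptacleEngineCellsDefs.lean`, proposal p156691 — INLINE copies below until it lands):
* `stub_zetaDecay_of_grh : GeneralizedRiemannHypothesis → FriableZetaLongRangeDecay` — H–T Lemma 8 (ii) for `3 ≤ |t| ≤ y¹²` under GRH (RH for ζ ⟹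
  twisted PNT with square-root error; the tree's decay stops at `κ√y`, too short for the major arcs `k ≤ y^{13/2}` that the sparse cell
  variables force).
* `stub_ceCells : FriableCharSumBound → FriableZetaLongRangeDecay → CECells` — class equidistribution inside shallow cells; mechanism: the EXACT class-uniformity
  identity `Literature.NumberTheory.Sieve.SmoothArcs.sum_coprime_classWeightedSum_mul_eq` (p154264) on the pure-principal trilinear form;
  only GRH (non-principal) and minor-arc errors remain (`ternary_holder_restriction` p149791, `norm_classProfileSum_free_le_of_minor` p153662,
  `ternary_circle_identity` p153387, classArcSum machinery p142375/p144782/p149813/p150543).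
* `stub_vmCells : FriableCharSumBound → FriableZetaLongRangeDecay → FamilySize → VMCells` — THE HARDEST (lead): first-order saddle precision (`scaledSum_main_term_quant`
  p151789, pointwise class/parity arc estimates p150543, model sums p154094, parity singular series p154890…p156478) with cancellation of the
  special member's own saddle error between the paired families (identical scalings/local data/dilated Θ-profiles).
* `stub_tailCells : FamilySize → TailCells` — Hölder–restriction (p149791) + Rankin at the master saddle (p149594), coprimality dropped.
* `stub_familySize : FriableCharSumBound → FriableZetaLongRangeDecay → FamilySize` — zeroth-order major arcs + Bonferroni over small common primes.
* `stub_nonemptyCells : FamilySize → NonemptyCells` — `Ψ(x,y)³/x → ∞`.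
* `stub_keyCellStructure_of_cells : CECells → VMCells → TailCells → NonemptyCells → KeyCellStructure (1/4)` — bookkeeping.
(`stub_shallowVD_nonneg` is the registered helper proved in the Defs file.)  Earlier skeletons' stubs `stub_HTLocalBehaviour`,
`stub_cellLawsAnalytic`, `stub_keyCells_of_cellLaws[Log]`, `stub_tiltBound`, `stub_plateauProfiles`, `stub_profileCharSum` are landed or
superseded (the model-based packages `CellLawsPackage[₂]` cannot be met at the needed precision: the saddle main term's relative error is
`≍ 1/u`, and only DIFFERENCES of key quantities — which are model-free — enjoy the cancellations).
-/

-- `Summit.<Summit>.<Problem>` is the mandated summit-side namespace (CONVENTIONS §2); for the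
-- single-conjunct summit `ABC` the two coincide, so the duplicate `ABC.ABC` is deliberate.
set_option linter.dupNamespace false

noncomputable section

namespace Summit.ABC.ABC.Cruxes.TameLocalReceptacle.GrhFriableCellResolution

open Finset
open Summit.ABC.ABC.Theses.CongruentialReceptacle
open Summit.ABC.ABC.Theorems.TameLocalReceptacle
open Literature.NumberTheory.LFunctions
open Literature.NumberTheory.Sieve
open Literature.NumberTheory.Sieve.TwistedWeight

/-! ## The registered target (refuting direction) -/

/-- The line's typed target: the NEGATION of the crux decl.  Registered with
`ledger skeleton check … --crux-decl Summit.ABC.ABC.Cruxes.TameLocalReceptacle.GrhFriableCellResolution.NotTameLocalReceptacle`. -/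
def NotTameLocalReceptacle : Prop := ¬ TameLocalReceptacle

/-! ## Vocabulary: `Theorems/CongruentialReceptacleTameLocalReceptacleEngineCellsDefs.lean` (p156691) — `masterScale`, `levelOf`, `shallowOf`,
`famFA … famG'`, `CECells`, `shallowVD`, `VMCells`, `TailCells`, `FamilySize`, `NonemptyCells`; the decay fact
`Literature.NumberTheory.Sieve.FriableZetaLongRangeDecay` (p157329). -/

/-! ## Registered stubs -/

/-- STUB v6-1 (L; GRH non-principal + minor arcs + exact class-uniformity).  `CECells` from the currency and the decay. -/
theorem stub_ceCells : FriableCharSumBound → FriableZetaLongRangeDecay → CECells := by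
  sorry

/-- STUB v6-2 — THE HARDEST (XL; lead).  `VMCells`: cross-ratio comparison of four parity-class counts per pair, first-order saddle
precision `η ≍ log y/log x`, cancellation of the member's own error, partner terms `O(η q^{-1-α})`, Riemann/truncation `O(1/T)`. -/
theorem stub_vmCells : FriableCharSumBound → FriableZetaLongRangeDecay → FamilySize → VMCells := by
  sorry

/-- STUB v6-4 (L).  `FamilySize`: `#F ≥ c Ψ(x,y)³/x` — zeroth-order major-arc evaluation of the parity counts (main term
`𝓜³Πe^{-α} 𝔖 J_model/x`, `𝔖 ≥ 2(1−2^{-α})³ > 0`, `J_model > 0`), lower plateau profiles, Bonferroni over common primes `p ≤ P₀`. -/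
theorem stub_familySize : FriableCharSumBound → FriableZetaLongRangeDecay → FamilySize := by
  sorry

/-! ## Composition (sorry-free modulo the stubs) -/

/-- The currency: GRH ⟹ `FriableCharSumBound` (stubs 1, 2 of skeleton v1; landed p138685, p134590). -/
theorem friableCharSumBound_of_grh (hG : GeneralizedRiemannHypothesis) : FriableCharSumBound :=
  stub_friableCharSums_of_lindelof (stub_smoothLLindelof_of_grh hG)

/-- The engine composed: the currency and the decay give the key-cell structure at balance `1/4`. -/
theorem keyCellStructure_of_inputs (hF : FriableCharSumBound) (hD : FriableZetaLongRangeDecay) :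
    KeyCellStructure (1 / 4) :=
  stub_keyCellStructure_of_cells (stub_ceCells hF hD) (stub_vmCells hF hD (stub_familySize hF hD))
    (stub_tailCells (stub_familySize hF hD)) (stub_nonemptyCells (stub_familySize hF hD))

/-- GRH ⟹ MF(1/4). -/
theorem matchingHypothesis_of_grh (hG : GeneralizedRiemannHypothesis) : MatchingHypothesis :=
  stub_matchingFamilies_of_keyCells (1 / 4)
    (keyCellStructure_of_inputs (friableCharSumBound_of_grh hG) (stub_zetaDecay_of_grh hG))

/-- **Registered skeleton theorem**: under GRH the crux is false — concludes the line's typed target `NotTameLocalReceptacle` BY NAME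
from the stubs and the landed negative lemma `TameLocalReceptacle_false_of_MatchingHypothesis` (p121503). -/
theorem NotTameLocalReceptacle_of_grh (hG : GeneralizedRiemannHypothesis) : NotTameLocalReceptacle :=
  TameLocalReceptacle_false_of_MatchingHypothesis (matchingHypothesis_of_grh hG)

/-- The same, spelled with the crux decl. -/
theorem not_tameLocalReceptacle_of_grh (hG : GeneralizedRiemannHypothesis) : ¬ TameLocalReceptacle :=
  NotTameLocalReceptacle_of_grh hG

/-- Contrapositive — the currency for the route's tenure: the rank-2 crux implies the failure of GRH. -/
theorem not_grh_of_tameLocalReceptacle (h : TameLocalReceptacle) : ¬ GeneralizedRiemannHypothesis :=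
  fun hG => NotTameLocalReceptacle_of_grh hG h

end Summit.ABC.ABC.Cruxes.TameLocalReceptacle.GrhFriableCellResolution

end
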